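import Mathlib
import Summits.NavierStokesRegularity.NavierStokesRegularity.Theorems.TaoLadderRungTwoBreakBlowupRigidityOneClockFromPinning
import Summits.NavierStokesRegularity.NavierStokesRegularity.Theses.TaoLadderRungTwoBreak
import HarnessLib

/-!
# The FOUR-ITEM inviscid pinning bundle also delivers the route's LIVE consequence-crux K2ᵛ(1)
  `TaoLadderRungTwoBreak.EternalRigidityViscBddOne` (stmt-NavierStokesRegularity-20420) — by-name links for the
  extraction chain of `stub_eternalFromBlowup` of K2(1) `BlowupRigidityOne` (stmt-NavierStokesRegularity-20206)

MODEL lattice ODEs only (Tao 2016 §4, §6.4); nothing here is a statement about the Navier–Stokes equations; NO item is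
closed (`--supports stmt-NavierStokesRegularity-20206`). `m = 4` (route items).

The extraction `eternal_surviving_one_of_fourPinned` produces, from an exact flow carrying the four-item bundle
(type I, per-shell action ceiling, amplitude ceiling `B ν^j` with `(1+ε₀)⁻¹ ≤ ν²`, firing floor on every shell),
`∃ W, IsEternal ε₀ α W ∧ UniformBound W ∧ EternalSurvivingFwd 1 ε₀ W`. Since an inviscid admissible eternal solution
is a covariant-viscous one with `ν̂ = 0` (`IsEternal.isEternalVisc`), the same bundle attached to every robust blow-up
below a threshold gives BOTH registered statements by name:

* `eternalRigidityViscBdd_of_fourPinned` — at one spread `R`: bundle below `ε_s` ⇒ `EternalRigidityViscBdd R 1`;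
* `eternalRigidityViscBddOne_of_fourPinnedBlowups` — bundle for every `R ≥ 1` ⇒ the route decl
  `Theses.TaoLadderRungTwoBreak.EternalRigidityViscBddOne` (K2ᵛ(1), ⟨20420⟩, the consequence-crux CONSUMED by `closes`);
* `stubEternalFromBlowup_and_K2v_of_fourPinnedBlowups` — both conclusions at once.

So the ν = 0 four-item bundle («every robust blow-up of a fixed-spread table below threshold has an exact flow that
is type I and pinned at a surviving ratio») is a SECOND sufficient blow-up-side hypothesis for ⟨20420⟩, next to route
WakeRatchet's viscous `MinimalViscousBlowup` ⟨22743⟩ (whose extraction ⟨22744⟩ is proved). HONEST LABEL: the bundle is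
OPEN (type I = N-39; asymptotic self-similarity); nothing is closed; no summit is touched.
-/

noncomputable section

-- the summit and its single sub-problem share the name (CONVENTIONS §1)
set_option linter.dupNamespace false

open Set Filter Topology MeasureTheory

namespace Summit.NavierStokesRegularity.NavierStokesRegularity.Theorems

namespace BlowupRigidityOne

open Literature.Analysis.FluidPDE Literature.Analysis.FluidPDE.TaoCascade
open Summit.NavierStokesRegularity.NavierStokesRegularity.Theses.TaoLadderRungTwoBreak

/-- **At one spread `R`: the four-item bundle below a threshold gives `EternalRigidityViscBdd R 1`** (the tree's
K2ᵛ predicate: robust blow-up ⇒ `∃ ν̂ W, IsEternalVisc ε₀ ν̂ α W ∧ UniformBound W ∧ EternalSurvivingFwd 1 ε₀ W`), with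
`ν̂ = 0`. [cite: Tao2016AveragedNS, §4 Thm. 4.2 (statement shape), §6.4; KochNadirashviliSereginSverak2009, Thm 1.1 ff.; cell vocabulary] -/
theorem eternalRigidityViscBdd_of_fourPinned {R : ℝ}
    (H : ∃ εs : ℝ, 0 < εs ∧ ∀ ε₀ : ℝ, 0 < ε₀ → ε₀ ≤ εs →
      ∀ (α : (Fin 4 → Fin 4 → Fin 4 → ℤ × ℤ × ℤ → ℝ)) (X₀ : Fin 4 → ℝ),
        InTableClass R α → NoGlobalCascade ε₀ α X₀ →
        ∃ (T C A B ν cf : ℝ) (X : Fin 4 → ℤ → ℝ → ℝ), 0 < T ∧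
          (∀ i n, ContDiffOn ℝ 1 (X i n) (Set.Ico 0 T)) ∧
          (∀ i n t, 0 ≤ t → t < T → derivWithin (X i n) (Set.Ici 0) t = quadTerm ε₀ α X i n t) ∧
          (∀ (n : ℤ) (t : ℝ), 0 ≤ t → t < T → bigLam ε₀ ^ n * (T - t) * ‖shellVec X n t‖ ≤ C) ∧
          (∀ k : ℤ, IntegrableOn (fun t => ‖shellVec X k t‖) (Ico 0 T) ∧
            bigLam ε₀ ^ k * (∫ t in Ico 0 T, ‖shellVec X k t‖) ≤ A) ∧
          0 < ν ∧ (1 + ε₀)⁻¹ ≤ ν ^ 2 ∧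
          (∀ (j : ℤ) (t : ℝ), 0 ≤ t → t < T → ‖shellVec X j t‖ ≤ B * ν ^ j) ∧
          0 < cf ∧ (∀ k : ℕ, ∃ t : ℝ, 0 ≤ t ∧ t < T ∧ cf * (ν ^ 2) ^ k ≤ ‖shellVec X (k : ℤ) t‖ ^ 2)) :
    EternalRigidityViscBdd R 1 := by
  obtain ⟨εs, hεs, hH⟩ := H
  refine ⟨εs, hεs, fun ε₀ hε hεle α X₀ hα hNG => ?_⟩
  obtain ⟨T, C, A, B, ν, cf, X, hT, hC1, hmot, htypeI, hact, hν, hν1, hamp, hcf, hfire⟩ :=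
    hH ε₀ hε hεle α X₀ hα hNG
  obtain ⟨W, hW, hUB, hS⟩ := eternal_surviving_one_of_fourPinned hε hT hC1 hmot htypeI hact hν hν1 hamp hcf hfire
  exact ⟨0, W, hW.isEternalVisc, hUB, hS⟩

/-- **K2ᵛ(1) `EternalRigidityViscBddOne` (⟨20420⟩, the route's consequence-crux consumed by `closes`) FROM THE
FOUR-ITEM INVISCID PINNING BUNDLE** attached to every robust blow-up below a threshold, for every spread `R ≥ 1`.
A conditional closing: the conclusion is LITERALLY the route decl; the hypothesis is the open bundle.
[cite: Tao2016AveragedNS, §4 Thm. 4.2 (statement shape), §6.4; KochNadirashviliSereginSverak2009, Thm 1.1 ff.; cell vocabulary] -/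
theorem eternalRigidityViscBddOne_of_fourPinnedBlowups
    (H : ∀ R : ℝ, 1 ≤ R → ∃ εs : ℝ, 0 < εs ∧ ∀ ε₀ : ℝ, 0 < ε₀ → ε₀ ≤ εs →
      ∀ (α : (Fin 4 → Fin 4 → Fin 4 → ℤ × ℤ × ℤ → ℝ)) (X₀ : Fin 4 → ℝ),
        InTableClass R α → NoGlobalCascade ε₀ α X₀ →
        ∃ (T C A B ν cf : ℝ) (X : Fin 4 → ℤ → ℝ → ℝ), 0 < T ∧
          (∀ i n, ContDiffOn ℝ 1 (X i n) (Set.Ico 0 T)) ∧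
          (∀ i n t, 0 ≤ t → t < T → derivWithin (X i n) (Set.Ici 0) t = quadTerm ε₀ α X i n t) ∧
          (∀ (n : ℤ) (t : ℝ), 0 ≤ t → t < T → bigLam ε₀ ^ n * (T - t) * ‖shellVec X n t‖ ≤ C) ∧
          (∀ k : ℤ, IntegrableOn (fun t => ‖shellVec X k t‖) (Ico 0 T) ∧
            bigLam ε₀ ^ k * (∫ t in Ico 0 T, ‖shellVec X k t‖) ≤ A) ∧
          0 < ν ∧ (1 + ε₀)⁻¹ ≤ ν ^ 2 ∧
          (∀ (j : ℤ) (t : ℝ), 0 ≤ t → t < T → ‖shellVec X j t‖ ≤ B * ν ^ j) ∧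
          0 < cf ∧ (∀ k : ℕ, ∃ t : ℝ, 0 ≤ t ∧ t < T ∧ cf * (ν ^ 2) ^ k ≤ ‖shellVec X (k : ℤ) t‖ ^ 2)) :
    Summit.NavierStokesRegularity.NavierStokesRegularity.Theses.TaoLadderRungTwoBreak.EternalRigidityViscBddOne :=
  fun R hR => eternalRigidityViscBdd_of_fourPinned (H R hR)

/-- **Both registered statements at once**: from the four-item bundle, the signature of `stub_eternalFromBlowup` (⟨20206⟩'s
skeleton) AND the route decl `EternalRigidityViscBddOne` (⟨20420⟩).
[cite: Tao2016AveragedNS, §4 Thm. 4.2 (statement shape), §6.4; cell vocabulary] -/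
theorem stubEternalFromBlowup_and_K2v_of_fourPinnedBlowups
    (H : ∀ R : ℝ, 1 ≤ R → ∃ εs : ℝ, 0 < εs ∧ ∀ ε₀ : ℝ, 0 < ε₀ → ε₀ ≤ εs →
      ∀ (α : (Fin 4 → Fin 4 → Fin 4 → ℤ × ℤ × ℤ → ℝ)) (X₀ : Fin 4 → ℝ),
        InTableClass R α → NoGlobalCascade ε₀ α X₀ →
        ∃ (T C A B ν cf : ℝ) (X : Fin 4 → ℤ → ℝ → ℝ), 0 < T ∧
          (∀ i n, ContDiffOn ℝ 1 (X i n) (Set.Ico 0 T)) ∧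
          (∀ i n t, 0 ≤ t → t < T → derivWithin (X i n) (Set.Ici 0) t = quadTerm ε₀ α X i n t) ∧
          (∀ (n : ℤ) (t : ℝ), 0 ≤ t → t < T → bigLam ε₀ ^ n * (T - t) * ‖shellVec X n t‖ ≤ C) ∧
          (∀ k : ℤ, IntegrableOn (fun t => ‖shellVec X k t‖) (Ico 0 T) ∧
            bigLam ε₀ ^ k * (∫ t in Ico 0 T, ‖shellVec X k t‖) ≤ A) ∧
          0 < ν ∧ (1 + ε₀)⁻¹ ≤ ν ^ 2 ∧
          (∀ (j : ℤ) (t : ℝ), 0 ≤ t → t < T → ‖shellVec X j t‖ ≤ B * ν ^ j) ∧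
          0 < cf ∧ (∀ k : ℕ, ∃ t : ℝ, 0 ≤ t ∧ t < T ∧ cf * (ν ^ 2) ^ k ≤ ‖shellVec X (k : ℤ) t‖ ^ 2)) :
    (∀ R : ℝ, 1 ≤ R → ∃ εs : ℝ, 0 < εs ∧ ∀ ε₀ : ℝ, 0 < ε₀ → ε₀ ≤ εs →
      ∀ (α : (Fin 4 → Fin 4 → Fin 4 → ℤ × ℤ × ℤ → ℝ)) (X₀ : Fin 4 → ℝ),
        InTableClass R α → NoGlobalCascade ε₀ α X₀ →
        ∃ W : ℤ → ℝ → Em 4, IsEternal ε₀ α W ∧ EternalSurvivingFwd 1 ε₀ W) ∧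
    Summit.NavierStokesRegularity.NavierStokesRegularity.Theses.TaoLadderRungTwoBreak.EternalRigidityViscBddOne :=
  ⟨stub_eternalFromBlowup_of_fourPinnedBlowups H, eternalRigidityViscBddOne_of_fourPinnedBlowups H⟩

end BlowupRigidityOne

end Summit.NavierStokesRegularity.NavierStokesRegularity.Theorems

end
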